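import Mathlib
import Summits.Ventures.PercRepro.TriangleCapStarFamilyListWitness

/-!
# PercRepro — `k` BELOW THE THRESHOLDS: THE GENERAL STAR-FAMILY WITNESSES IN BOTH REGIMES (p3, gen 57; part 352)

THE LOWER REGIME `2 r ≤ D`, `m = D + r − 1 − k`, `1 ≤ k ≤ r − 1` (`zone_k_below_witness`): the short-list star family
of part 350 with `a = r − k` specials, `Rc = r` centre rows of which the first `k` are the row `{centre}`
(`sh ρ = D − 1` for `ρ < k`), `Q = D − 1` regular columns and no extra row is a graph of the band with
`2 j + 2 t (D − 1) = t (t − 1) + 2 (r − k) + (2 r − k)(D − 2 r + k) + k (D − 1)` — the abstract value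
`g(r − k) = 2 (r − k) + φ_D(2 r − k) + φ_D(k)` of `I = r − k` inside edges plus `k (k − 1)`: `k = 1` is the zone
witness of part 324 (`g(r − 1)`, exact by part 333), `k = 2` part 345 (`g(r − 2) + 2`).  It beats the bipartite value
`2 r (D − r)` iff `k (k − 1) < 2 (r − k)(r − k − 1)`.
THE UPPER REGIME `D < 2 r`, `ρ = D − r`, `X = D − 2 ρ ≥ k + 1`, `m = D + r − 2 − k` (`upper_zone_k_below_witness`):
`a = ρ`, `Rc = r`, `k` rows `{centre}` and one row of size `X − k` (`sh = (D − 1, …, D − 1, 2 ρ + k, 0, …)`),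
`Q = 2 r − 2 − k`, no extra row: value `t (t − 1) + 2 ρ (X + 1) + 2 k X − k (k + 1)` — the residue minimum
`g(ρ)` plus `2 k X − k (k + 1)`: `k = 1` is the wide witness of part 344 (`2 X − 2`, exact), `k = 2` part 351
(`4 X − 6`).  Both families live on `ℓ = m + 1` columns with `m + k + 1` active rows and every column full
(`I = r − k` resp. `I = ρ`).  Checked at the graph level on 89 + 94 cells (mining/p3/g57/shortlist.py).
Axioms: standard.
-/

namespace PercRepro

namespace TriangleCap

namespace C047

open Finset

/-- The short list of the lower regime: `k` rows `{centre}`. -/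
def shK (D k ρ : ℕ) : ℕ := if ρ < k then D - 1 else 0

/-- `Σ_{ρ < r} shK = k (D − 1)` for `k ≤ r`. -/
theorem sum_shK (D k r : ℕ) (hk : k ≤ r) : ∑ ρ ∈ range r, shK D k ρ = k * (D - 1) := by
  rw [← sum_subset (range_subset_range.mpr hk) (fun ρ _ hρ => by
    rw [mem_range, not_lt] at hρ
    unfold shK
    rw [if_neg (by omega)])]
  rw [sum_congr rfl (fun ρ hρ => by
    unfold shK
    rw [if_pos (mem_range.mp hρ)]), sum_const, card_range, smul_eq_mul]

/-- `Σ_{ρ < r} (D − shK ρ) shK ρ = k (D − (D − 1)) (D − 1)` for `k ≤ r`. -/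
theorem sum_def_shK (D k r : ℕ) (hk : k ≤ r) :
    ∑ ρ ∈ range r, (D - shK D k ρ) * shK D k ρ = k * ((D - (D - 1)) * (D - 1)) := by
  rw [← sum_subset (range_subset_range.mpr hk) (fun ρ _ hρ => by
    rw [mem_range, not_lt] at hρ
    unfold shK
    rw [if_neg (by omega), mul_zero])]
  rw [sum_congr rfl (fun ρ hρ => by
    unfold shK
    rw [if_pos (mem_range.mp hρ)]), sum_const, card_range, smul_eq_mul]

/-- The value identity of the lower regime: `2 (r − k) + (2 r − k)(D − 2 r + k) + k (D − 1)`. -/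
theorem k_below_value_arith (D r k : ℕ) (hk1 : 1 ≤ k) (hk : k + 1 ≤ r) (h2 : 2 * r ≤ D) :
    2 * (r - k) + ((r + (r - k)) * (D - (r + (r - k))) + k * ((D - (D - 1)) * (D - 1))) =
      2 * (r - k) + (2 * r - k) * (D - 2 * r + k) + k * (D - 1) := by
  obtain ⟨r', rfl⟩ : ∃ r', r = k + 1 + r' := ⟨r - k - 1, by omega⟩
  obtain ⟨u, rfl⟩ : ∃ u, D = 2 * (k + 1 + r') + u := ⟨D - 2 * (k + 1 + r'), by omega⟩
  have e1 : k + 1 + r' - k = r' + 1 := by omega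
  have e2 : 2 * (k + 1 + r') + u - (k + 1 + r' + (r' + 1)) = k + u := by omega
  have e3 : 2 * (k + 1 + r') + u - (2 * (k + 1 + r') + u - 1) = 1 := by omega
  have e4 : 2 * (k + 1 + r') + u - 1 = 2 * k + 2 * r' + u + 1 := by omega
  have e5 : 2 * (k + 1 + r') - k = k + 2 * r' + 2 := by omega
  have e6 : 2 * (k + 1 + r') + u - 2 * (k + 1 + r') + k = u + k := by omega
  rw [e1, e2, e3, e4, e5, e6]
  ring

/-- **`k` BELOW THE THRESHOLD, LOWER REGIME — THE WITNESS:** for `1 ≤ k ≤ r − 1`, `2 r ≤ D`, `m + 1 + k = D + r`,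
`t = m D + r`, `m + 1 ≤ ℓ`, `2 t ≤ s`: a graph of the band (triangle-free, `s` edges, `w` of degree `s − t`, every
off-degree `≤ D`, a non-neighbour of off-degree exactly `D`) with
`2 j + 2 t (D − 1) = t (t − 1) + 2 (r − k) + (2 r − k)(D − 2 r + k) + k (D − 1)`. -/
theorem zone_k_below_witness (s ℓ m r D k : ℕ) (hk1 : 1 ≤ k) (hk : k + 1 ≤ r) (h2 : 2 * r ≤ D)
    (hm : m + 1 + k = D + r) (hmℓ : m + 1 ≤ ℓ) (hs : 2 * (m * D + r) ≤ s) :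
    ∃ (H : SimpleGraph (Fin (ℓ + 1 + (s - (m * D + r))))) (_ : DecidableRel H.Adj), H.CliqueFree 3 ∧
      H.edgeFinset.card = s ∧ ∃ w, deg H w + (m * D + r) = s ∧ (∀ v, offDeg H w v ≤ D) ∧
        (∃ x, ¬ H.Adj w x ∧ offDeg H w x = D) ∧
        ∃ j, ∑ v, deg H v * deg H v + 2 * ((m * D + r) * (s - (m * D + r) - 1)) + 2 * j = s * (s + 1) ∧
          2 * j + 2 * ((m * D + r) * (D - 1)) =
            (m * D + r) * (m * D + r - 1) + (2 * (r - k) + (2 * r - k) * (D - 2 * r + k) + k * (D - 1)) := by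
  have hr : k ≤ r := by omega
  have ht : m * D + r = r + (r - k) * (D - 1) + (D - 1) * D + (r - k) := by
    obtain ⟨r', rfl⟩ : ∃ r', r = k + 1 + r' := ⟨r - k - 1, by omega⟩
    obtain ⟨D', rfl⟩ : ∃ D', D = D' + 1 := ⟨D - 1, by omega⟩
    have hm' : m = D' + r' + 1 := by omega
    subst hm'
    have e1 : k + 1 + r' - k = r' + 1 := by omega
    rw [e1, Nat.add_sub_cancel]
    ring
  have hinc : r * (D - 1) + (D - 1) * (D - (r - k)) + 0 * D = (D - 1) * D + ∑ ρ ∈ range r, shK D k ρ := by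
    rw [sum_shK D k r hr]
    obtain ⟨r', rfl⟩ : ∃ r', r = k + 1 + r' := ⟨r - k - 1, by omega⟩
    obtain ⟨D', rfl⟩ : ∃ D', D = D' + 1 := ⟨D - 1, by omega⟩
    have e1 : k + 1 + r' - k = r' + 1 := by omega
    have e2 : D' + 1 - (r' + 1) = D' - r' := by omega
    rw [e1, Nat.add_sub_cancel, e2]
    obtain ⟨u, hu⟩ : ∃ u, D' = r' + u := ⟨D' - r', by omega⟩
    subst hu
    rw [Nat.add_sub_cancel_left]
    ring
  have hsh : ∀ ρ < r, shK D k ρ + 1 ≤ D := by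
    intro ρ _
    unfold shK
    split_ifs <;> omega
  obtain ⟨H, inst, hfree, hcard, w, hw, hD', hx, j, hj, hval⟩ :=
    starFamilyListWitness s ℓ (m * D + r) D (r - k) r (shK D k) 0 (D - 1) ht (by omega) (by omega) (by omega) hsh
      (by omega) (by omega) (fun h => by omega) hinc (by omega) hs
  refine ⟨H, inst, hfree, hcard, w, hw, hD', hx, j, hj, ?_⟩
  rw [hval, sum_def_shK D k r hr]
  have harith := k_below_value_arith D r k hk1 hk h2
  omega

/-- The short list of the upper regime: `k` rows `{centre}`, then a row short by `2 ρ + k` (`ρ = D − r`). -/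
def shKB (D r k ρ : ℕ) : ℕ := if ρ < k then D - 1 else if ρ = k then 2 * (D - r) + k else 0

/-- `Σ_{ρ < r} shKB = k (D − 1) + (2 ρ + k)` for `k + 1 ≤ r`. -/
theorem sum_shKB (D r k : ℕ) (hk : k + 1 ≤ r) :
    ∑ ρ ∈ range r, shKB D r k ρ = k * (D - 1) + (2 * (D - r) + k) := by
  rw [← sum_subset (range_subset_range.mpr hk) (fun ρ _ hρ => by
    rw [mem_range, not_lt] at hρ
    unfold shKB
    rw [if_neg (by omega), if_neg (by omega)]), sum_range_succ]
  rw [sum_congr rfl (fun ρ hρ => by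
    unfold shKB
    rw [if_pos (mem_range.mp hρ)]), sum_const, card_range, smul_eq_mul]
  unfold shKB
  rw [if_neg (by omega), if_pos rfl]

/-- `Σ_{ρ < r} (D − shKB ρ) shKB ρ = k (D − (D − 1))(D − 1) + (D − (2 ρ + k))(2 ρ + k)` for `k + 1 ≤ r`. -/
theorem sum_def_shKB (D r k : ℕ) (hk : k + 1 ≤ r) :
    ∑ ρ ∈ range r, (D - shKB D r k ρ) * shKB D r k ρ =
      k * ((D - (D - 1)) * (D - 1)) + (D - (2 * (D - r) + k)) * (2 * (D - r) + k) := by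
  rw [← sum_subset (range_subset_range.mpr hk) (fun ρ _ hρ => by
    rw [mem_range, not_lt] at hρ
    unfold shKB
    rw [if_neg (by omega), if_neg (by omega), mul_zero]), sum_range_succ]
  rw [sum_congr rfl (fun ρ hρ => by
    unfold shKB
    rw [if_pos (mem_range.mp hρ)]), sum_const, card_range, smul_eq_mul]
  unfold shKB
  rw [if_neg (by omega), if_pos rfl]

/-- The value identity of the upper regime: `2 ρ + k (D − 1) + (D − 2 ρ − k)(2 ρ + k) = 2 ρ (X + 1) + 2 k X − k (k + 1)`
with `ρ = D − r`, `X = D − 2 ρ ≥ k + 1`. -/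
theorem k_below_upper_value_arith (D r k : ℕ) (hk1 : 1 ≤ k) (hX : D + k + 1 ≤ 2 * r) (h2 : r + 2 ≤ D) :
    2 * (D - r) + ((r + (D - r)) * (D - (r + (D - r))) +
      (k * ((D - (D - 1)) * (D - 1)) + (D - (2 * (D - r) + k)) * (2 * (D - r) + k))) =
      2 * ((D - r) * (D - 2 * (D - r) + 1)) + (2 * k * (D - 2 * (D - r)) - k * (k + 1)) := by
  obtain ⟨ρ, rfl⟩ : ∃ ρ, D = r + ρ := ⟨D - r, by omega⟩
  obtain ⟨X', rfl⟩ : ∃ X', r = ρ + k + 1 + X' := ⟨r - ρ - k - 1, by omega⟩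
  have e1 : ρ + k + 1 + X' + ρ - (ρ + k + 1 + X') = ρ := by omega
  have e2 : ρ + k + 1 + X' + ρ - (ρ + k + 1 + X' + ρ) = 0 := by omega
  have e3 : ρ + k + 1 + X' + ρ - (ρ + k + 1 + X' + ρ - 1) = 1 := by omega
  have e4 : ρ + k + 1 + X' + ρ - 1 = 2 * ρ + k + X' := by omega
  have e5 : ρ + k + 1 + X' + ρ - (2 * ρ + k) = X' + 1 := by omega
  have e6 : ρ + k + 1 + X' + ρ - 2 * ρ + 1 = k + X' + 2 := by omega
  have e7 : ρ + k + 1 + X' + ρ - 2 * ρ = k + 1 + X' := by omega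
  rw [e1, e2, e3, e4, e5, e6, e7]
  have e8 : 2 * k * (k + 1 + X') - k * (k + 1) = k * (k + 1) + 2 * k * X' := by
    have : 2 * k * (k + 1 + X') = k * (k + 1) + (k * (k + 1) + 2 * k * X') := by ring
    omega
  rw [e8]
  ring

/-- **`k` BELOW THE THRESHOLD, UPPER REGIME — THE WITNESS:** for `1 ≤ k`, `D + k + 1 ≤ 2 r` (i.e. `X ≥ k + 1`),
`r + 2 ≤ D`, `m + 2 + k = D + r`, `t = m D + r`, `m + 1 ≤ ℓ`, `2 t ≤ s`: a graph of the band with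
`2 j + 2 t (D − 1) = t (t − 1) + 2 ρ (D − 2 ρ + 1) + (2 k (D − 2 ρ) − k (k + 1))`, `ρ = D − r`. -/
theorem upper_zone_k_below_witness (s ℓ m r D k : ℕ) (hk1 : 1 ≤ k) (hX : D + k + 1 ≤ 2 * r) (h2 : r + 2 ≤ D)
    (hm : m + 2 + k = D + r) (hmℓ : m + 1 ≤ ℓ) (hs : 2 * (m * D + r) ≤ s) :
    ∃ (H : SimpleGraph (Fin (ℓ + 1 + (s - (m * D + r))))) (_ : DecidableRel H.Adj), H.CliqueFree 3 ∧
      H.edgeFinset.card = s ∧ ∃ w, deg H w + (m * D + r) = s ∧ (∀ v, offDeg H w v ≤ D) ∧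
        (∃ x, ¬ H.Adj w x ∧ offDeg H w x = D) ∧
        ∃ j, ∑ v, deg H v * deg H v + 2 * ((m * D + r) * (s - (m * D + r) - 1)) + 2 * j = s * (s + 1) ∧
          2 * j + 2 * ((m * D + r) * (D - 1)) = (m * D + r) * (m * D + r - 1) +
            (2 * ((D - r) * (D - 2 * (D - r) + 1)) + (2 * k * (D - 2 * (D - r)) - k * (k + 1))) := by
  have hkr : k + 1 ≤ r := by omega
  have ht : m * D + r = r + (D - r) * (D - 1) + (2 * r - 2 - k) * D + (D - r) := by
    obtain ⟨ρ, rfl⟩ : ∃ ρ, D = r + ρ := ⟨D - r, by omega⟩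
    obtain ⟨r', rfl⟩ : ∃ r', r = k + 2 + r' := ⟨r - k - 2, by omega⟩
    have hm' : m = k + 2 + 2 * r' + ρ := by omega
    subst hm'
    have e1 : k + 2 + r' + ρ - (k + 2 + r') = ρ := by omega
    have e2 : k + 2 + r' + ρ - 1 = k + r' + ρ + 1 := by omega
    have e3 : 2 * (k + 2 + r') - 2 - k = k + 2 * r' + 2 := by omega
    rw [e1, e2, e3]
    ring
  have hinc : r * (D - 1) + (D - 1) * (D - (D - r)) + 0 * D = (2 * r - 2 - k) * D + ∑ ρ ∈ range r, shKB D r k ρ := by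
    rw [sum_shKB D r k hkr]
    obtain ⟨ρ, rfl⟩ : ∃ ρ, D = r + ρ := ⟨D - r, by omega⟩
    obtain ⟨r', rfl⟩ : ∃ r', r = k + 2 + r' := ⟨r - k - 2, by omega⟩
    have e1 : k + 2 + r' + ρ - (k + 2 + r') = ρ := by omega
    have e2 : k + 2 + r' + ρ - 1 = k + r' + ρ + 1 := by omega
    have e3 : 2 * (k + 2 + r') - 2 - k = k + 2 * r' + 2 := by omega
    have e4 : k + 2 + r' + ρ - ρ = k + 2 + r' := by omega
    rw [e1, e2, e3, e4]
    ring
  have hsh : ∀ ρ < r, shKB D r k ρ + 1 ≤ D := by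
    intro ρ _
    unfold shKB
    split_ifs <;> omega
  obtain ⟨H, inst, hfree, hcard, w, hw, hD', hx, j, hj, hval⟩ :=
    starFamilyListWitness s ℓ (m * D + r) D (D - r) r (shKB D r k) 0 (2 * r - 2 - k) ht (by omega) (by omega)
      (by omega) hsh (by omega) (by omega) (fun h => by omega) hinc (by omega) hs
  refine ⟨H, inst, hfree, hcard, w, hw, hD', hx, j, hj, ?_⟩
  rw [hval, sum_def_shKB D r k hkr]
  have harith := k_below_upper_value_arith D r k hk1 hX h2
  omega

end C047

end TriangleCap

end PercRepro
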